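import Summits.KontsevichZagierPeriods.KontsevichZagierPeriods.Theses.TorsionLogs
import Summits.KontsevichZagierPeriods.KontsevichZagierPeriods.Theorems.TorsionLogsNeronTorsionSector
import Literature.NumberTheory.Transcendental.KZKernelConjectureForms

/-!
# Crux `TorsionSectorComplete` (stmt-KontsevichZagierPeriods-14212) — line `NeronTorsionComplex`
# (forward generator G1 `next-rung` over the floor `NeronTorsionPrimitiveChain`, unit fwd2-rung-KontsevichZagierPeriods-01, gen 8)

Route `TorsionLogs` (route-KontsevichZagierPeriods-TorsionLogs; `closes (h₁ : NeronTorsionSector)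
(h₂ : TorsionSectorComplete) : KontsevichZagierPeriods`; `h₁` CLOSED by the landed translation chain
`NeronTorsionSector_of = NeronTorsionSector_of_primitiveChain stub_assembly`, `h₂` the open residual).

## The rung: NON-REAL torsion points of a real curve (the second period pair enters)

The floor `stub_assembly : NeronTorsionPrimitiveChain` (seed g1-KontsevichZagierPeriods-17981) and every forward line
filed on it so far (shifted η-carrier, two torsion corners, oval component, duplication, distribution, addition,
pinned height) work with REAL points of a real Weierstrass curve `y² = f(x) = 4x³ − g₂x − g₃`: the integrals are
iterated integrals along REAL arcs, the lattice datum is `N·u_P = a·ω₁`, and only the real period pair `(ω₁, η₁)`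
appears.  Over `ℚ̄` almost all torsion points of a real curve are NON-REAL: `u_P = (a·ω₁ + b·ω₂)/N` with `b ≢ 0`.
For such `P = (x_P, y_P) ∈ E(ℂ) ∖ E(ℝ)` (three real roots `e₃ < e₂ < e₁`, `0 < e₁`, `ω₂ = 2i·W₀`,
`W₀ = ∫_{e₂}^{e₁} dx/√(−f)`, `H₀ = ∫_{e₂}^{e₁} x dx/√(−f)`, so that `ω₂η₂ = 4·W₀·H₀` and Legendre reads
`η₁W₀ + ω₁H₀ = π`) the Néron function `Λ(u) = −log|σ(u)| + ½·Re(u·η(u))` gives, along the straight segment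
`x(s) = e₁ + s(x_P − e₁)` from the 2-torsion corner `T₁ = (e₁, 0)` to `P` lifted with the continuous branch `y_c`,
`y_c(1) = y_P`:

  (★)  `Re I_ℂ(P) + ρ²·(ω₁η₁/2) + β²·(ω₂η₂/2) = Λ(P) − Λ(T₁) = log|ψ_{N−1}(P)|/(N²−2N) − log|ψ₃(e₁)|/8 =: log α_P`,
       `I_ℂ(P) = ∬_{0<s'<s<1} (x_P−e₁)² x(s') ds' ds/(y_c(s') y_c(s))`, `ρ = 1/2 − a/N`, `β = b/N`, `α_P ∈ ℚ̄ ∩ ℝ_{>0}`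

(`|·|` the complex modulus; `ψ_n` the division polynomials of `℘, ℘'`; the REAL PART is lift-independent; checked to
`6·10⁻¹⁶` on 8 (curve, point) pairs incl. `y² = 4x³ − 28x + 24`, `P = (1 − 2i, 4 + 8i)` of order 4 with
`u_P = (ω₁ + ω₂)/4`, where `32·Re I_ℂ(P) + ω₁η₁ + ω₂η₂ = 4·log(32/5)`; folder `num/complex_torsion.py`).
At `b = 0` this is the floor's identity.  NEW OBJECTS: integral representations whose integrands are REAL PARTS of
algebraic functions along a complex segment (still `ℚ`-semialgebraic real functions on real simplices — inside KZ's
calculus), the second period pair `(ω₂, η₂)` as the product representation `rQ = [(e₂,e₁)², (1/√(−f(x)))·x'/√(−f(x'))]`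
of value `W₀H₀ = ω₂η₂/4`, and the complex lattice datum `N·u_P = a·ω₁ + b·ω₂`.

THE NEW MOVE (stub 1, torsion-free): the CONJUGATE FOLD.  For ANY non-real point `P` of a real curve the quasi-
parallelogram law at the conjugate pair `(P, P̄)` — `Λ(P+P̄) + Λ(P−P̄) = 4Λ(P) − log|x_P − x̄_P|`, `Λ(P̄) = Λ(P)` — lands
on two REAL points: `S = P + P̄` on the identity component of `E` and, through `Λ_E(it) = Λ_{E⁻}(t)` for the twist
`E⁻ : y² = f⁻(x) = −f(−x) = 4x³ − g₂x + g₃` (real period `2W₀`, quasi-period `iη₂`, so `ω₁⁻η₁⁻/2 = ω₂η₂/2`), the point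
`D'` of `E⁻(ℝ)` with `x(D') = −x(P − P̄)`.  In integral form, for the principal lift (`0 < Re u_P < ω₁/2`,
`0 < Im u_P < W₀`):

  (♣)  `32·Re I_ℂ(P) − 8·I(S) − 8·I⁻(D') − 2·(ω₁η₁/2) − 8·η₁·Re ∫_seg − 4·W₀H₀ + 16·H₀·Im ∫_seg = 8·LOG`,
       `∫_seg = ∫₀¹ (x_P−e₁) ds/y_c(s) = u_P − ω₁/2`,  `LOG = log|ψ₃(e₃)|/8 − 3·log|ψ₃(e₁)|/8 + log|x_P − x̄_P|`,

every term an explicit 2-dimensional representation (`η₁·Re ∫_seg` and `H₀·Im ∫_seg` are product representations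
`R₁`, `R₂`) and the right-hand side the log of a real algebraic number (checked to `3·10⁻¹⁵` on 9 non-real points of
5 curves, torsion or not; `num/conjugate_fold.py`).  Realising (♣) by KZ moves = moving a complex path across a
conjugation-symmetric homotopy by rule 3 with ALGEBRAIC primitives (the integrands themselves: `d(ηω) = 0` on the
curve) and the addition shear at the pair `(P, P̄)`; the floor's real monotone cells (`stub_gridData`,
`realDictionary`) and its period symmetry `chain_to_logClass … hper hsym` never leave the real locus — that is the
exact step of the seed's proof that fails here.

STUB 2 (torsion elimination on the real side): for a non-real `N`-torsion point, `S` is a real torsion point of `E`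
(`N·u_S = 2a·ω₁`) and `D'` a real torsion point of `E⁻` (`N·t_{D'} = 2b·(2W₀)`): two instances of the SEED (on `E`
and on `E⁻`, whose largest root `−e₃ = e₁ + e₂` is positive), the Möbius transport of the `E⁻`-carrier onto `2·rQ`
(translation by a 2-torsion point, as in line `NeronTorsionOval`), the complex torsion period relations
`N·[R₁] + (N−2a)·[rP]`, `N·[R₂] − 2b·[rQ] ∈ relations` (real and imaginary parts of `N·u_P = aω₁ + bω₂`, times a
factor), and integer elimination give the primitive complex chain
`A•[rI] + B₁•[rP] + B₂•[rQ] − c•[log B] ∈ relations` for every integer vector `(A, B₁, B₂)` on the tie line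
`4N²B₁ = A(N−2a)²`, `N²B₂ = 2Ab²` (multiples of one chain).

RUNG `NeronTorsionComplexPoints := ∀ nonReal : Bool, NeronTorsionPointSector nonReal`, member `false` =
`Theses.TorsionLogs.NeronTorsionSector` VERBATIM (F3 witness `neronTorsionPointSector_false` names the seed), member
`true` = the tied complex sector (ties `4N²k₁ = M(N−2a)²`, `N²k₂ = 2Mb²`, value hypothesis; under the ties the value
hypothesis is the multiplicative relation `α^m = α_P^M` between real algebraic numbers — no hidden transcendence).
F4: the summit implies the rung in five lines per member (`neronTorsionComplexPoints_of_kontsevichZagierPeriods`).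
RESIDUAL (stub 3) = completeness of the moves relative to `relations ⊔ closure (T ∪ T^{ℂ})` — weaker than the crux as
typed (`complexPointsComplete_of_torsionSectorComplete`), conjecture-grade, declared residual.

Stubs (registered): `stub_conjugateFold` (M–L, the new move), `stub_realSideElimination` (M–L, two seed instances +
carrier transport + torsion periods + elimination), `stub_complexPointsComplete` (residual).  Sorry-free:
`complexSector_of_chain` (bookkeeping: soundness for the value, the landed interval-log calculus, algebraicity of the
end point of a log carrier), `neronTorsionComplexPoints_of` (= `Rung_of`), `neronTorsionPointSector_false` (F3),
`neronTorsionComplexPoints_of_kontsevichZagierPeriods` (F4), `closure_complexTied_le_relations`,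
`complexPointsComplete_of_torsionSectorComplete`, `TorsionSectorComplete_of` (the crux BY NAME).
[cite: KontsevichZagier2001, §1.1–1.2] [cite: Lang1983, Ch. 13 Thm 1.1] [cite: Silverman1994, VI Thm 3.2, Cor 3.3, Ex 6.4(e)] [cite: SilvermanAEC2009, III.2.3]
-/

noncomputable section

open Set MeasureTheory Filter Topology
open Literature.NumberTheory.Transcendental Literature.ModelTheory.ExponentialFields
open Summit.KontsevichZagierPeriods.KontsevichZagierPeriods.Theses.TorsionLogs (NeronTorsionSector TorsionSectorComplete)
open Summit.KontsevichZagierPeriods.HyperbolicBloch.OffTetraSectorKernel (interval_log_relation_mem_relations)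
open Summit.KontsevichZagierPeriods.KontsevichZagierPeriods.Cruxes.NeronTorsionSector.Translation (logRep_value
  isAlgebraic_of_logRep NeronTorsionSector_of_primitiveChain stub_assembly NeronTorsionSector_of)

-- `Summit.KontsevichZagierPeriods.KontsevichZagierPeriods.…` is the tree's mandated layout (single-conjunct summit).
set_option linter.dupNamespace false

namespace Summit.KontsevichZagierPeriods.KontsevichZagierPeriods.Cruxes.TorsionSectorComplete.NeronTorsionComplex

/-! ### The rung family (indexed by: is the torsion point non-real?) -/

/-- The tied Néron–torsion sector at a torsion point of a real Weierstrass curve.  `false`: a REAL torsion point on the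
identity component — `Theses.TorsionLogs.NeronTorsionSector` verbatim (tie `4N²k = M(N−2a)²`).  `true`: a NON-REAL
torsion point `P = (x_P, y_P)`, `Im x_P ≠ 0`, of a real curve with three real roots (`e₂ < e₁` roots, `f < 0` between
them, `0 < e₁`), continuous branch `y_c` of `y` along the segment `x(s) = e₁ + s(x_P − e₁)`, `y_c(1) = y_P`, complex
lattice datum `N·(ω₁/2 + ∫₀¹ (x_P−e₁) ds/y_c(s)) = a·ω₁ + b·(2iW₀)` with `0 < 2a < N`, `0 < 2b < N` (principal lift),
representations `rI = [0<s'<s<1, Re((x_P−e₁)² x(s')/(y_c(s')y_c(s)))]`, the floor's carrier `rP` (value `ω₁η₁/2`),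
`rQ = [(e₂,e₁)², (1/√(−f(x)))·x'/√(−f(x'))]` (value `W₀H₀ = ω₂η₂/4`), log carrier `rL = [1<t<α, dt/t]`, ties
`4N²k₁ = M(N−2a)²`, `N²k₂ = 2Mb²`, value hypothesis.  CLAIM: `M•[rI] + k₁•[rP] + k₂•[rQ] − m•[rL] ∈ relations`.
[cite: KontsevichZagier2001, §1.2] [cite: Lang1983, Ch. 13 Thm 1.1] -/
def NeronTorsionPointSector : Bool → Prop
  | false => ∀ (g₂ g₃ e₁ xP yP α : ℝ) (N a : ℕ) (M k m : ℤ) (f : ℝ → ℝ), (∀ x, f x = 4 * x ^ 3 - g₂ * x - g₃) → g₂ ^ 3 - 27 * g₃ ^ 2 ≠ 0 → f e₁ = 0 → 0 < e₁ → (∀ x, e₁ < x → 0 < f x) → e₁ < xP → yP ^ 2 = f xP → 3 ≤ N → 0 < a → 2 * a < N → 4 * (N : ℤ) ^ 2 * k = M * ((N : ℤ) - 2 * (a : ℤ)) ^ 2 → (∀ hns : (⟨0, 0, 0, -g₂ / 4, -g₃ / 4⟩ : WeierstrassCurve ℝ).toAffine.Nonsingular xP (yP / 2), addOrderOf (WeierstrassCurve.Affine.Point.some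 xP (yP / 2) hns) = N) → (N : ℝ) * (∫ x in Set.Ioi xP, (Real.sqrt (f x))⁻¹) = a * (2 * ∫ x in Set.Ioi e₁, (Real.sqrt (f x))⁻¹) → 1 < α → ∀ (rI rP : Literature.NumberTheory.Transcendental.KZ.IntegralRep 2) (rL : Literature.NumberTheory.Transcendental.KZ.IntegralRep 1), rI.domain = {z | e₁ < z 1 ∧ z 1 < z 0 ∧ z 0 < xP} → Set.EqOn rI.integrand (fun z => z 1 / (Real.sqrt (f (z 1)) * Real.sqrt (f (z 0)))) rI.domain → rP.domain = {z | e₁ < z 0 ∧ e₁ < z 1} → Set.EqOn rP.integrand (fun z => (Real.sqrt (f (z 0)))⁻¹ * ((g₂ * z 1 + 2 * g₃) / (2 * (z 1) ^ 2 * Real.sqrt (f (z 1))))) rP.domain → rL.domain = {t | 1 < t 0 ∧ t 0 < α} → Set.EqOn rL.integrand (fun t => (t 0)⁻¹) rL.domain → (M : ℝ) * rI.value + k * rP.value = m * rL.value → M • Literature.NumberTheory.Transcendental.KZ.of rI + k • Literature.NumberTheory.Transcendental.KZ.of rP - m • Literature.NumberTheory.Transcendental.KZ.of rL ∈ Lit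erature.NumberTheory.Transcendental.KZ.relations
  | true => ∀ (g₂ g₃ e₁ e₂ α : ℝ) (xP yP : ℂ) (yc : ℝ → ℂ) (N a b : ℕ) (M k₁ k₂ m : ℤ) (f : ℝ → ℝ), (∀ x, f x = 4 * x ^ 3 - g₂ * x - g₃) → g₂ ^ 3 - 27 * g₃ ^ 2 ≠ 0 → f e₁ = 0 → f e₂ = 0 → e₂ < e₁ → 0 < e₁ → (∀ x, e₁ < x → 0 < f x) → (∀ x, e₂ < x → x < e₁ → f x < 0) → xP.im ≠ 0 → yP ^ 2 = 4 * xP ^ 3 - (g₂ : ℂ) * xP - (g₃ : ℂ) → ContinuousOn yc (Set.Icc 0 1) → yc 1 = yP → (∀ s ∈ Set.Icc (0 : ℝ) 1, yc s ^ 2 = 4 * ((e₁ : ℂ) + (s : ℂ) * (xP - e₁)) ^ 3 - (g₂ : ℂ) * ((e₁ : ℂ) + (s : ℂ) * (xP - e₁)) - (g₃ : ℂ)) → (∀ s ∈ Set.Ioc (0 : ℝ) 1, yc s ≠ 0) → 3 ≤ N → 0 < a → 2 * a < N → 0 < b → 2 * b < N → (N : ℂ) * (((∫ x in Set.Ioi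 e₁, (Real.sqrt (f x))⁻¹ : ℝ) : ℂ) + ∫ s in Set.Ioo (0 : ℝ) 1, (xP - e₁) / yc s) = (a : ℂ) * (((2 * ∫ x in Set.Ioi e₁, (Real.sqrt (f x))⁻¹ : ℝ) : ℂ)) + (b : ℂ) * (((2 * ∫ x in Set.Ioo e₂ e₁, (Real.sqrt (-f x))⁻¹ : ℝ) : ℂ)) * Complex.I → 4 * (N : ℤ) ^ 2 * k₁ = M * ((N : ℤ) - 2 * (a : ℤ)) ^ 2 → (N : ℤ) ^ 2 * k₂ = 2 * M * (b : ℤ) ^ 2 → 1 < α → ∀ (rI rP rQ : Literature.NumberTheory.Transcendental.KZ.IntegralRep 2) (rL : Literature.NumberTheory.Transcendental.KZ.IntegralRep 1), rI.domain = {z | 0 < z 1 ∧ z 1 < z 0 ∧ z 0 < 1} → Set.EqOn rI.integrand (fun z => ((xP - e₁) ^ 2 * ((e₁ : ℂ) + ((z 1 : ℝ) : ℂ) * (xP - e₁)) / (yc (z 1) * yc (z 0))).re) rI.domain → rP.domain = {z | e₁ < z 0 ∧ e₁ < z 1} → Set.EqOn rP.integrand (fun z => (Real.sqrt (f (z 0)))⁻¹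 * ((g₂ * z 1 + 2 * g₃) / (2 * (z 1) ^ 2 * Real.sqrt (f (z 1))))) rP.domain → rQ.domain = {z | e₂ < z 0 ∧ z 0 < e₁ ∧ e₂ < z 1 ∧ z 1 < e₁} → Set.EqOn rQ.integrand (fun z => (Real.sqrt (-f (z 0)))⁻¹ * (z 1 / Real.sqrt (-f (z 1)))) rQ.domain → rL.domain = {t | 1 < t 0 ∧ t 0 < α} → Set.EqOn rL.integrand (fun t => (t 0)⁻¹) rL.domain → (M : ℝ) * rI.value + k₁ * rP.value + k₂ * rQ.value = m * rL.value → M • Literature.NumberTheory.Transcendental.KZ.of rI + k₁ • Literature.NumberTheory.Transcendental.KZ.of rP + k₂ • Literature.NumberTheory.Transcendental.KZ.of rQ - m • Literature.NumberTheory.Transcendental.KZ.of rL ∈ Literature.NumberTheory.Transcendental.KZ.relations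

/-- **THE RUNG.** The tied Néron–torsion sector at EVERY torsion point — real (identity component; the floor's crux,
closed) or non-real (new) — of a real Weierstrass curve. [cite: KontsevichZagier2001, §1.2] -/
def NeronTorsionComplexPoints : Prop := ∀ nonReal : Bool, NeronTorsionPointSector nonReal

/-- The primitive complex chain (the `∃`-form the stubs produce): for the data of the non-real member and EVERY
integer vector `(A, B₁, B₂)` on the tie line `4N²B₁ = A(N−2a)²`, `N²B₂ = 2Ab²` there are `c ∈ ℤ`, a real algebraic
`B > 1` and a log carrier `rB = [1<t<B, dt/t]` with `A•[rI] + B₁•[rP] + B₂•[rQ] − c•[rB] ∈ relations`.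
(All integer vectors on the line are the multiples of the primitive one, so this is one chain.)
[cite: KontsevichZagier2001, §1.2] [cite: Lang1983, Ch. 13 Thm 1.1] -/
def ComplexPrimitiveChain : Prop := ∀ (g₂ g₃ e₁ e₂ : ℝ) (xP yP : ℂ) (yc : ℝ → ℂ) (N a b : ℕ) (f : ℝ → ℝ), (∀ x, f x = 4 * x ^ 3 - g₂ * x - g₃) → g₂ ^ 3 - 27 * g₃ ^ 2 ≠ 0 → f e₁ = 0 → f e₂ = 0 → e₂ < e₁ → 0 < e₁ → (∀ x, e₁ < x → 0 < f x) → (∀ x, e₂ < x → x < e₁ → f x < 0) → xP.im ≠ 0 → yP ^ 2 = 4 * xP ^ 3 - (g₂ : ℂ) * xP - (g₃ : ℂ) → ContinuousOn yc (Set.Icc 0 1) → yc 1 = yP → (∀ s ∈ Set.Icc (0 : ℝ) 1, yc s ^ 2 = 4 * ((e₁ : ℂ) + (s : ℂ) * (xP - e₁)) ^ 3 - (g₂ : ℂ) * ((e₁ : ℂ) + (s : ℂ) * (xP - e₁)) - (g₃ : ℂ)) → (∀ s ∈ Set.Ioc (0 : ℝ) 1, yc s ≠ 0) → 3 ≤ N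 → 0 < a → 2 * a < N → 0 < b → 2 * b < N → (N : ℂ) * (((∫ x in Set.Ioi e₁, (Real.sqrt (f x))⁻¹ : ℝ) : ℂ) + ∫ s in Set.Ioo (0 : ℝ) 1, (xP - e₁) / yc s) = (a : ℂ) * (((2 * ∫ x in Set.Ioi e₁, (Real.sqrt (f x))⁻¹ : ℝ) : ℂ)) + (b : ℂ) * (((2 * ∫ x in Set.Ioo e₂ e₁, (Real.sqrt (-f x))⁻¹ : ℝ) : ℂ)) * Complex.I → ∀ (A B₁ B₂ : ℤ), 4 * (N : ℤ) ^ 2 * B₁ = A * ((N : ℤ) - 2 * (a : ℤ)) ^ 2 → (N : ℤ) ^ 2 * B₂ = 2 * A * (b : ℤ) ^ 2 → ∀ (rI rP rQ : Literature.NumberTheory.Transcendental.KZ.IntegralRep 2), rI.domain = {z | 0 < z 1 ∧ z 1 < z 0 ∧ z 0 < 1} → Set.EqOn rI.integrand (fun z => ((xP - e₁) ^ 2 * ((e₁ : ℂ) + ((z 1 : ℝ) : ℂ) * (xP - e₁)) / (yc (z 1) * yc (z 0))).re) rI.domain → rP.domain = {z | e₁ < z 0 ∧ e₁ < z 1} →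 Set.EqOn rP.integrand (fun z => (Real.sqrt (f (z 0)))⁻¹ * ((g₂ * z 1 + 2 * g₃) / (2 * (z 1) ^ 2 * Real.sqrt (f (z 1))))) rP.domain → rQ.domain = {z | e₂ < z 0 ∧ z 0 < e₁ ∧ e₂ < z 1 ∧ z 1 < e₁} → Set.EqOn rQ.integrand (fun z => (Real.sqrt (-f (z 0)))⁻¹ * (z 1 / Real.sqrt (-f (z 1)))) rQ.domain → ∃ (c : ℤ) (B : ℝ) (rB : Literature.NumberTheory.Transcendental.KZ.IntegralRep 1), 1 < B ∧ IsAlgebraic ℚ B ∧ rB.domain = {t | 1 < t 0 ∧ t 0 < B} ∧ Set.EqOn rB.integrand (fun t => (t 0)⁻¹) rB.domain ∧ A • Literature.NumberTheory.Transcendental.KZ.of rI + B₁ • Literature.NumberTheory.Transcendental.KZ.of rP + B₂ • Literature.NumberTheory.Transcendental.KZ.of rQ - c • Literature.NumberTheory.Transcendental.KZ.of rB ∈ Literature.NumberTheory.Transcendental.KZ.relations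

/-! ### Stub statements -/

/-- **Stub 1 statement (the new move, torsion-free): the CONJUGATE FOLD.**  For a real curve with three real roots
(`e₂ < e₁` roots, `f < 0` on `(e₂,e₁)`, `0 < e₁`, `Δ ≠ 0`), ANY non-real point `P = (x_P, y_P)` with a continuous
branch `y_c` along the segment from `T₁ = (e₁,0)` whose lift is principal (`−ω₁/2 < Re ∫_seg < 0`,
`0 < Im ∫_seg < W₀`), the real points `S = P + P̄ ∈ E(ℝ)` (`x_S = (Im y_P/Im x_P)²/4 − 2Re x_P`) and
`D' ∈ E⁻(ℝ)`, `E⁻ : y² = −f(−x)` (`x_{D'} = (Re y_P/Im x_P)²/4 + 2Re x_P = −x(P − P̄)`), and the representations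
`rI` (complex triangle, real part), `rJ = [e₁<x'<x<x_S, x'/(√f√f')]`, `rK = [e₁+e₂<x'<x<x_{D'}, x'/(√f⁻√f⁻')]`,
`rP` (floor carrier), `R₁ = [(0,1)×(e₁,∞), Re((x_P−e₁)/y_c(s))·(g₂x'+2g₃)/(2x'²√f(x'))]`,
`R₂ = [(0,1)×(e₂,e₁), Im((x_P−e₁)/y_c(s))·x'/√(−f(x'))]`, `rQ`:  there are `c ∈ ℤ`, a real algebraic `B > 1` and
a log carrier `rB` with
`32•[rI] − 8•[rJ] − 8•[rK] − 2•[rP] − 8•[R₁] + 16•[R₂] − 4•[rQ] − c•[rB] ∈ relations`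
(value identity (♣) of the module docstring: the quasi-parallelogram law at `(P, P̄)` and `Λ_E(it) = Λ_{E⁻}(t)`;
moves: rule 3 across the conjugation-symmetric homotopy with the integrands as primitives, the addition shear at the
conjugate pair, Newton–Leibniz for the logarithm). [cite: KontsevichZagier2001, §1.2 rules 1–3]
[cite: SilvermanAEC2009, III.2.3 (addition formula)] [cite: Silverman1994, VI Thm 3.2, Cor 3.3] [cite: Lang1983, Ch. 13] -/
def ConjugateFold : Prop := ∀ (g₂ g₃ e₁ e₂ xS xD : ℝ) (xP yP : ℂ) (yc : ℝ → ℂ) (f : ℝ → ℝ), (∀ x, f x = 4 * x ^ 3 - g₂ * x - g₃) → g₂ ^ 3 - 27 * g₃ ^ 2 ≠ 0 → f e₁ = 0 → f e₂ = 0 → e₂ < e₁ → 0 < e₁ → (∀ x, e₁ < x → 0 < f x) → (∀ x, e₂ < x → x < e₁ → f x < 0) → xP.im ≠ 0 → yP ^ 2 = 4 * xP ^ 3 - (g₂ : ℂ) * xP - (g₃ : ℂ) → ContinuousOn yc (Set.Icc 0 1) → yc 1 = yP → (∀ s ∈ Set.Icc (0 : ℝ) 1, yc s ^ 2 = 4 *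 ((e₁ : ℂ) + (s : ℂ) * (xP - e₁)) ^ 3 - (g₂ : ℂ) * ((e₁ : ℂ) + (s : ℂ) * (xP - e₁)) - (g₃ : ℂ)) → (∀ s ∈ Set.Ioc (0 : ℝ) 1, yc s ≠ 0) → -(∫ x in Set.Ioi e₁, (Real.sqrt (f x))⁻¹) < (∫ s in Set.Ioo (0 : ℝ) 1, (xP - e₁) / yc s).re → (∫ s in Set.Ioo (0 : ℝ) 1, (xP - e₁) / yc s).re < 0 → 0 < (∫ s in Set.Ioo (0 : ℝ) 1, (xP - e₁) / yc s).im → (∫ s in Set.Ioo (0 : ℝ) 1, (xP - e₁) / yc s).im < ∫ x in Set.Ioo e₂ e₁, (Real.sqrt (-f x))⁻¹ → xS = (yP.im / xP.im) ^ 2 / 4 - 2 * xP.re → xD = (yP.re / xP.im) ^ 2 / 4 + 2 * xP.re → ∀ (rI rJ rK rP R₁ R₂ rQ : Literature.NumberTheory.Transcendental.KZ.IntegralRep 2), rI.domain = {z | 0 < z 1 ∧ z 1 < z 0 ∧ z 0 < 1} → Set.EqOn rI.integrand (fun z => ((xP - e₁) ^ 2 * ((e₁ : ℂ) + ((z 1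 : ℝ) : ℂ) * (xP - e₁)) / (yc (z 1) * yc (z 0))).re) rI.domain → rJ.domain = {z | e₁ < z 1 ∧ z 1 < z 0 ∧ z 0 < xS} → Set.EqOn rJ.integrand (fun z => z 1 / (Real.sqrt (f (z 1)) * Real.sqrt (f (z 0)))) rJ.domain → rK.domain = {z | e₁ + e₂ < z 1 ∧ z 1 < z 0 ∧ z 0 < xD} → Set.EqOn rK.integrand (fun z => z 1 / (Real.sqrt (-f (-z 1)) * Real.sqrt (-f (-z 0)))) rK.domain → rP.domain = {z | e₁ < z 0 ∧ e₁ < z 1} → Set.EqOn rP.integrand (fun z => (Real.sqrt (f (z 0)))⁻¹ * ((g₂ * z 1 + 2 * g₃) / (2 * (z 1) ^ 2 * Real.sqrt (f (z 1))))) rP.domain → R₁.domain = {z | 0 < z 0 ∧ z 0 < 1 ∧ e₁ < z 1} → Set.EqOn R₁.integrand (fun z => ((xP - e₁) / yc (z 0)).re * ((g₂ * z 1 + 2 * g₃) / (2 * (z 1) ^ 2 * Real.sqrt (f (z 1))))) R₁.domain → R₂.domain = {z | 0 < z 0 ∧ z 0 < 1 ∧ e₂ < z 1 ∧ z 1 <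 e₁} → Set.EqOn R₂.integrand (fun z => ((xP - e₁) / yc (z 0)).im * (z 1 / Real.sqrt (-f (z 1)))) R₂.domain → rQ.domain = {z | e₂ < z 0 ∧ z 0 < e₁ ∧ e₂ < z 1 ∧ z 1 < e₁} → Set.EqOn rQ.integrand (fun z => (Real.sqrt (-f (z 0)))⁻¹ * (z 1 / Real.sqrt (-f (z 1)))) rQ.domain → ∃ (c : ℤ) (B : ℝ) (rB : Literature.NumberTheory.Transcendental.KZ.IntegralRep 1), 1 < B ∧ IsAlgebraic ℚ B ∧ rB.domain = {t | 1 < t 0 ∧ t 0 < B} ∧ Set.EqOn rB.integrand (fun t => (t 0)⁻¹) rB.domain ∧ (32 : ℤ) • Literature.NumberTheory.Transcendental.KZ.of rI - (8 : ℤ) • Literature.NumberTheory.Transcendental.KZ.of rJ - (8 : ℤ) • Literature.NumberTheory.Transcendental.KZ.of rK - (2 : ℤ) • Literature.NumberTheory.Transcendental.KZ.of rP - (8 : ℤ) • Literature.NumberTheory.Transcendental.KZ.of R₁ + (16 : ℤ) • Literature.NumberTheory.Transcendental.KZ.of R₂ - (4 : ℤ) • Literature.NumberTheory.Transcendental.KZ.of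 rQ - c • Literature.NumberTheory.Transcendental.KZ.of rB ∈ Literature.NumberTheory.Transcendental.KZ.relations

/-- **Stub 2 statement: torsion elimination on the real side.**  The conjugate fold gives the primitive complex
chain: at a non-real `N`-torsion point with principal lift, `S = P + P̄` is a real torsion point of `E` with
`N·u_S = 2a·ω₁` and `D'` a real torsion point of `E⁻` with `N·t_{D'} = 2b·(2W₀)` — run the SEED twice (on `E`, and on
`E⁻` whose largest root `e₁ + e₂ = −e₃ > 0`; the seed never uses its order hypothesis, cf. `NeronTorsionOval`),
transport the `E⁻`-carrier onto `2•[rQ]` by the 2-torsion Möbius translation, kill `R₁`, `R₂` by the real and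
imaginary parts of the lattice datum (`N•[R₁] + (N−2a)•[rP]`, `N•[R₂] − 2b•[rQ] ∈ relations`), eliminate with integer
coefficients. [cite: KontsevichZagier2001, §1.2] [cite: Lang1983, Ch. 13 Thm 1.1] -/
def RealSideElimination : Prop := ConjugateFold → ComplexPrimitiveChain

/-- The identity-component tied set `T` of the crux `TorsionSectorComplete` (copied verbatim). -/
def TorsionTied : Set Literature.NumberTheory.Transcendental.KZ.FormalRep := {d : Literature.NumberTheory.Transcendental.KZ.FormalRep | ∃ (g₂ g₃ e₁ xP yP α : ℝ) (N a : ℕ) (M k m : ℤ) (f : ℝ → ℝ) (rI rP : Literature.NumberTheory.Transcendental.KZ.IntegralRep 2) (rL : Literature.NumberTheory.Transcendental.KZ.IntegralRep 1), (∀ x, f x = 4 * x ^ 3 - g₂ * x - g₃) ∧ g₂ ^ 3 - 27 * g₃ ^ 2 ≠ 0 ∧ f e₁ = 0 ∧ 0 < e₁ ∧ (∀ x, e₁ < x → 0 < f x) ∧ e₁ < xP ∧ yP ^ 2 = f xP ∧ 3 ≤ N ∧ 0 < a ∧ 2 * a < N ∧ 4 * (N : ℤ) ^ 2 * k = M * ((N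 : ℤ) - 2 * (a : ℤ)) ^ 2 ∧ (∀ hns : (⟨0, 0, 0, -g₂ / 4, -g₃ / 4⟩ : WeierstrassCurve ℝ).toAffine.Nonsingular xP (yP / 2), addOrderOf (WeierstrassCurve.Affine.Point.some xP (yP / 2) hns) = N) ∧ (N : ℝ) * (∫ x in Set.Ioi xP, (Real.sqrt (f x))⁻¹) = a * (2 * ∫ x in Set.Ioi e₁, (Real.sqrt (f x))⁻¹) ∧ 1 < α ∧ rI.domain = {z | e₁ < z 1 ∧ z 1 < z 0 ∧ z 0 < xP} ∧ Set.EqOn rI.integrand (fun z => z 1 / (Real.sqrt (f (z 1)) * Real.sqrt (f (z 0)))) rI.domain ∧ rP.domain = {z | e₁ < z 0 ∧ e₁ < z 1} ∧ Set.EqOn rP.integrand (fun z => (Real.sqrt (f (z 0)))⁻¹ * ((g₂ * z 1 + 2 * g₃) / (2 * (z 1) ^ 2 * Real.sqrt (f (z 1))))) rP.domain ∧ rL.domain = {t | 1 < t 0 ∧ t 0 < α} ∧ Set.EqOn rL.integrand (fun t => (t 0)⁻¹) rL.domain ∧ (M : ℝ) * rI.value + k * rP.value = m * rL.value ∧ d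 = M • Literature.NumberTheory.Transcendental.KZ.of rI + k • Literature.NumberTheory.Transcendental.KZ.of rP - m • Literature.NumberTheory.Transcendental.KZ.of rL}

/-- The complex tied set `T^{ℂ}` (the elements of the member `true`). -/
def ComplexTied : Set Literature.NumberTheory.Transcendental.KZ.FormalRep := {d : Literature.NumberTheory.Transcendental.KZ.FormalRep | ∃ (g₂ g₃ e₁ e₂ α : ℝ) (xP yP : ℂ) (yc : ℝ → ℂ) (N a b : ℕ) (M k₁ k₂ m : ℤ) (f : ℝ → ℝ) (rI rP rQ : Literature.NumberTheory.Transcendental.KZ.IntegralRep 2) (rL : Literature.NumberTheory.Transcendental.KZ.IntegralRep 1), (∀ x, f x = 4 * x ^ 3 - g₂ * x - g₃) ∧ g₂ ^ 3 - 27 * g₃ ^ 2 ≠ 0 ∧ f e₁ = 0 ∧ f e₂ = 0 ∧ e₂ < e₁ ∧ 0 < e₁ ∧ (∀ x, e₁ < x → 0 < f x) ∧ (∀ x, e₂ < x → x < e₁ → f x < 0) ∧ xP.im ≠ 0 ∧ yP ^ 2 = 4 * xP ^ 3 - (g₂ : ℂ) * xP - (g₃ : ℂ) ∧ ContinuousOn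 yc (Set.Icc 0 1) ∧ yc 1 = yP ∧ (∀ s ∈ Set.Icc (0 : ℝ) 1, yc s ^ 2 = 4 * ((e₁ : ℂ) + (s : ℂ) * (xP - e₁)) ^ 3 - (g₂ : ℂ) * ((e₁ : ℂ) + (s : ℂ) * (xP - e₁)) - (g₃ : ℂ)) ∧ (∀ s ∈ Set.Ioc (0 : ℝ) 1, yc s ≠ 0) ∧ 3 ≤ N ∧ 0 < a ∧ 2 * a < N ∧ 0 < b ∧ 2 * b < N ∧ (N : ℂ) * (((∫ x in Set.Ioi e₁, (Real.sqrt (f x))⁻¹ : ℝ) : ℂ) + ∫ s in Set.Ioo (0 : ℝ) 1, (xP - e₁) / yc s) = (a : ℂ) * (((2 * ∫ x in Set.Ioi e₁, (Real.sqrt (f x))⁻¹ : ℝ) : ℂ)) + (b : ℂ) * (((2 * ∫ x in Set.Ioo e₂ e₁, (Real.sqrt (-f x))⁻¹ : ℝ) : ℂ)) * Complex.I ∧ 4 * (N : ℤ) ^ 2 * k₁ = M * ((N : ℤ) - 2 * (a : ℤ)) ^ 2 ∧ (N : ℤ) ^ 2 * k₂ = 2 * M * (b : ℤ) ^ 2 ∧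 1 < α ∧ rI.domain = {z | 0 < z 1 ∧ z 1 < z 0 ∧ z 0 < 1} ∧ Set.EqOn rI.integrand (fun z => ((xP - e₁) ^ 2 * ((e₁ : ℂ) + ((z 1 : ℝ) : ℂ) * (xP - e₁)) / (yc (z 1) * yc (z 0))).re) rI.domain ∧ rP.domain = {z | e₁ < z 0 ∧ e₁ < z 1} ∧ Set.EqOn rP.integrand (fun z => (Real.sqrt (f (z 0)))⁻¹ * ((g₂ * z 1 + 2 * g₃) / (2 * (z 1) ^ 2 * Real.sqrt (f (z 1))))) rP.domain ∧ rQ.domain = {z | e₂ < z 0 ∧ z 0 < e₁ ∧ e₂ < z 1 ∧ z 1 < e₁} ∧ Set.EqOn rQ.integrand (fun z => (Real.sqrt (-f (z 0)))⁻¹ * (z 1 / Real.sqrt (-f (z 1)))) rQ.domain ∧ rL.domain = {t | 1 < t 0 ∧ t 0 < α} ∧ Set.EqOn rL.integrand (fun t => (t 0)⁻¹) rL.domain ∧ (M : ℝ) * rI.value + k₁ * rP.value + k₂ * rQ.value = m * rL.value ∧ d = M • Literature.NumberTheory.Transcendental.KZ.of rI + k₁ • Literature.NumberTheory.Transcendental.KZ.of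 rP + k₂ • Literature.NumberTheory.Transcendental.KZ.of rQ - m • Literature.NumberTheory.Transcendental.KZ.of rL}

/-- **Stub 3 statement (residual, conjecture-grade): completeness off the real AND the complex torsion sectors.**
Two rational-shape representations with equal values differ by an element of `relations ⊔ closure (T ∪ T^{ℂ})`.
Strictly between `KZKernelConjecture` (`relations` alone) and the crux (`relations ⊔ closure T`).
[cite: KontsevichZagier2001, §1.2 Conjecture 1] -/
def ComplexPointsComplete : Prop := ∀ ⦃n m : ℕ⦄ (r : Literature.NumberTheory.Transcendental.KZ.IntegralRep n) (r' : Literature.NumberTheory.Transcendental.KZ.IntegralRep m), r.IsRational → r'.IsRational → r.value = r'.value → Literature.NumberTheory.Transcendental.KZ.of r - Literature.NumberTheory.Transcendental.KZ.of r' ∈ Literature.NumberTheory.Transcendental.KZ.relations ⊔ AddSubgroup.closure (TorsionTied ∪ ComplexTied)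

/-! ### Registered stubs -/

/-- **Stub 1 (M–L, load-bearing, the new move).** `ConjugateFold`. -/
theorem stub_conjugateFold : ConjugateFold := by
  sorry

/-- **Stub 2 (M–L).** `RealSideElimination` — two seed instances (on `E` and on the twist `E⁻`), the Möbius carrier
transport, the complex torsion period relations, integer elimination. -/
theorem stub_realSideElimination : RealSideElimination := by
  sorry

/-- **Stub 3 (residual, conjecture-grade).** `ComplexPointsComplete`. -/
theorem stub_complexPointsComplete : ComplexPointsComplete := by
  sorry

/-! ### Proved infrastructure (no `sorry` below this line) -/

/-- The crux unfolds to completeness relative to `relations ⊔ closure T`. -/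
theorem torsionSectorComplete_iff :
    Summit.KontsevichZagierPeriods.KontsevichZagierPeriods.Theses.TorsionLogs.TorsionSectorComplete ↔
      ∀ ⦃n m : ℕ⦄ (r : Literature.NumberTheory.Transcendental.KZ.IntegralRep n)
        (r' : Literature.NumberTheory.Transcendental.KZ.IntegralRep m), r.IsRational → r'.IsRational →
        r.value = r'.value → Literature.NumberTheory.Transcendental.KZ.of r - Literature.NumberTheory.Transcendental.KZ.of r' ∈
          Literature.NumberTheory.Transcendental.KZ.relations ⊔ AddSubgroup.closure TorsionTied :=
  Iff.rfl

/-- Member `false` of the family is `NeronTorsionSector` on the nose. -/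
theorem neronTorsionPointSector_false_iff :
    NeronTorsionPointSector false ↔
      Summit.KontsevichZagierPeriods.KontsevichZagierPeriods.Theses.TorsionLogs.NeronTorsionSector :=
  Iff.rfl

/-- The primitive complex chain follows from the two content stubs. -/
theorem complexPrimitiveChain_of (h₁ : ConjugateFold) (h₂ : RealSideElimination) : ComplexPrimitiveChain := h₂ h₁

/-- **Bookkeeping: the primitive complex chain gives the tied complex sector** — the chain at the vector
`(A, B₁, B₂) = (M, k₁, k₂)` (on the tie line by hypothesis), soundness of the calculus for the value, algebraicity of
the end point of a log carrier, and the landed interval-log calculus for `c•[rB] − m•[rL]`.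
[cite: KontsevichZagier2001, §1.2] [cite: Lang1983, Ch. 13 Thm 1.1] -/
theorem complexSector_of_chain (hPC : ComplexPrimitiveChain) : NeronTorsionPointSector true := by
  intro g₂ g₃ e₁ e₂ α xP yP yc N a b M k₁ k₂ m f hf hdisc he₁ he₂ h21 he₁0 hpos hneg him hyP hyc hyc1 hycsq hyc0 hN
    ha ha2 hb hb2 htor htie₁ htie₂ hα rI rP rQ rL hdI hiI hdP hiP hdQ hiQ hdL hiL hval
  obtain ⟨c, B, rB, hB, hBalg, hdB, hiB, hprim⟩ :=
    hPC g₂ g₃ e₁ e₂ xP yP yc N a b f hf hdisc he₁ he₂ h21 he₁0 hpos hneg him hyP hyc hyc1 hycsq hyc0 hN ha ha2 hb hb2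
      htor M k₁ k₂ htie₁ htie₂ rI rP rQ hdI hiI hdP hiP hdQ hiQ
  have hvB : rB.value = Real.log B := logRep_value hB.le rB hdB hiB
  have hvL : rL.value = Real.log α := logRep_value hα.le rL hdL hiL
  have hαalg : IsAlgebraic ℚ α := isAlgebraic_of_logRep hα rL hdL
  have h0 : (M : ℝ) * rI.value + (k₁ : ℝ) * rP.value + (k₂ : ℝ) * rQ.value - c * Real.log B = 0 := by
    have h := KZ.relations_le_ker_eval_holds hprim
    rw [AddMonoidHom.mem_ker] at h
    simpa only [map_add, map_sub, map_zsmul, KZ.eval_of, zsmul_eq_mul, hvB] using h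
  have hlog : (c : ℝ) * Real.log B - m * Real.log α = 0 := by
    rw [hvL] at hval
    linear_combination hval - h0
  have hiB1 : Set.EqOn rB.integrand (fun t : Fin 1 → ℝ => 1 / t 0) rB.domain := fun t ht => by
    simp only [hiB ht, one_div]
  have hiL1 : Set.EqOn rL.integrand (fun t : Fin 1 → ℝ => 1 / t 0) rL.domain := fun t ht => by
    simp only [hiL ht, one_div]
  have hL : c • KZ.of rB - m • KZ.of rL ∈ KZ.relations := by
    have h := interval_log_relation_mem_relations 2 ![1, 1] ![B, α] ![c, -m] ![rB, rL]
      (fun i => by fin_cases i <;> simp)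
      (fun i => by fin_cases i <;> simp [hB.le, hα.le])
      (fun i => by fin_cases i <;> exact isAlgebraic_one)
      (fun i => by fin_cases i <;> simp [hBalg, hαalg])
      (fun i => by
        fin_cases i
        · exact ⟨hdB, hiB1⟩
        · exact ⟨hdL, hiL1⟩)
      (by
        simp only [Fin.sum_univ_two, Matrix.cons_val_zero, Matrix.cons_val_one, div_one, Int.cast_neg]
        linear_combination hlog)
    have e : ∑ i : Fin 2, (![c, -m] i : ℤ) • KZ.of (![rB, rL] i) = c • KZ.of rB - m • KZ.of rL := by
      simp only [Fin.sum_univ_two, Matrix.cons_val_zero, Matrix.cons_val_one, neg_smul]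
      abel
    rw [e] at h
    exact h
  have e : M • KZ.of rI + k₁ • KZ.of rP + k₂ • KZ.of rQ - m • KZ.of rL =
      (M • KZ.of rI + k₁ • KZ.of rP + k₂ • KZ.of rQ - c • KZ.of rB) + (c • KZ.of rB - m • KZ.of rL) := by
    abel
  rw [e]
  exact KZ.relations.add_mem hprim hL

/-- **F3 WITNESS — the floor is the member `false` of the family** (names the seed `stub_assembly`). -/
theorem neronTorsionPointSector_false : NeronTorsionPointSector false :=
  neronTorsionPointSector_false_iff.mpr (NeronTorsionSector_of_primitiveChain stub_assembly)

/-- **The rung from stubs 1–2** (`<Rung>_of`): member `false` is the floor's chain (landed), member `true` is the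
conjugate fold + real-side torsion elimination + bookkeeping. [cite: KontsevichZagier2001, §1.2] -/
theorem neronTorsionComplexPoints_of (h₁ : ConjugateFold) (h₂ : RealSideElimination) :
    NeronTorsionComplexPoints := by
  intro b
  cases b
  · exact neronTorsionPointSector_false
  · exact complexSector_of_chain (complexPrimitiveChain_of h₁ h₂)

/-- The rung itself from the registered stubs (closed term). -/
theorem neronTorsionComplexPoints_holds : NeronTorsionComplexPoints :=
  neronTorsionComplexPoints_of stub_conjugateFold stub_realSideElimination

/-- The complex member says exactly `closure T^{ℂ} ≤ KZ.relations`. [cite: KontsevichZagier2001, §1.2] -/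
theorem closure_complexTied_le_relations (h : NeronTorsionPointSector true) :
    AddSubgroup.closure ComplexTied ≤ Literature.NumberTheory.Transcendental.KZ.relations := by
  refine (AddSubgroup.closure_le _).mpr ?_
  rintro d ⟨g₂, g₃, e₁, e₂, α, xP, yP, yc, N, a, b, M, k₁, k₂, m', f, rI, rP, rQ, rL, hf, hdisc, he₁, he₂, h21, he₁0,
    hpos, hneg, him, hyP, hyc, hyc1, hycsq, hyc0, hN, ha, ha2, hb, hb2, htor, htie₁, htie₂, hα, hdI, hiI, hdP, hiP,
    hdQ, hiQ, hdL, hiL, hval, rfl⟩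
  exact h g₂ g₃ e₁ e₂ α xP yP yc N a b M k₁ k₂ m' f hf hdisc he₁ he₂ h21 he₁0 hpos hneg him hyP hyc hyc1 hycsq hyc0
    hN ha ha2 hb hb2 htor htie₁ htie₂ hα rI rP rQ rL hdI hiI hdP hiP hdQ hiQ hdL hiL hval

/-- The identity member says exactly `closure T ≤ KZ.relations`. [cite: KontsevichZagier2001, §1.2] -/
theorem closure_torsionTied_le_relations (h : NeronTorsionPointSector false) :
    AddSubgroup.closure TorsionTied ≤ Literature.NumberTheory.Transcendental.KZ.relations := by
  refine (AddSubgroup.closure_le _).mpr ?_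
  rintro d ⟨g₂, g₃, e₁, xP, yP, α, N, a, M, k, m', f, rI, rP, rL, hf, hdisc, he, he0, hpos, hx, hy, hN, ha,
    ha', htie, hord, htor, hα, hdI, hiI, hdP, hiP, hdL, hiL, hval, rfl⟩
  exact h g₂ g₃ e₁ xP yP α N a M k m' f hf hdisc he he0 hpos hx hy hN ha ha' htie hord htor hα rI rP rL hdI hiI
    hdP hiP hdL hiL hval

/-- **F4 ON-PATH LEMMA — the summit implies the rung** (Conjecture 1 in kernel form,
`kzKernelConjecture_iff_isRational`; a tied element of either member evaluates to `0` by its value hypothesis).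
Tagged `@[simp]` so that the tribunal's forward probe `S → Rung` closes by `intro h; aesop`.
[cite: KontsevichZagier2001, §1.2] -/
@[simp] theorem neronTorsionComplexPoints_of_kontsevichZagierPeriods (h : _root_.KontsevichZagierPeriods) :
    NeronTorsionComplexPoints := by
  have hK : KZKernelConjecture := kzKernelConjecture_iff_isRational.mpr h
  intro b
  cases b
  · intro g₂ g₃ e₁ xP yP α N a M k m f _ _ _ _ _ _ _ _ _ _ _ _ _ _ rI rP rL _ _ _ _ _ _ hval
    apply hK
    rw [map_sub, map_add, map_zsmul, map_zsmul, map_zsmul, KZ.eval_of, KZ.eval_of, KZ.eval_of, zsmul_eq_mul,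
      zsmul_eq_mul, zsmul_eq_mul]
    linarith [hval]
  · intro g₂ g₃ e₁ e₂ α xP yP yc N a b M k₁ k₂ m f _ _ _ _ _ _ _ _ _ _ _ _ _ _ _ _ _ _ _ _ _ _ _ rI rP rQ rL _ _ _ _
      _ _ _ _ hval
    apply hK
    rw [map_sub, map_add, map_add, map_zsmul, map_zsmul, map_zsmul, map_zsmul, KZ.eval_of, KZ.eval_of, KZ.eval_of,
      KZ.eval_of, zsmul_eq_mul, zsmul_eq_mul, zsmul_eq_mul, zsmul_eq_mul]
    linarith [hval]

/-- The residual is a consequence of the crux (hence of the summit): `closure T ≤ closure (T ∪ T^{ℂ})`.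
(Informational: stub 3 is WEAKER than the crux as typed.) [folklore] -/
theorem complexPointsComplete_of_torsionSectorComplete
    (h : Summit.KontsevichZagierPeriods.KontsevichZagierPeriods.Theses.TorsionLogs.TorsionSectorComplete) :
    ComplexPointsComplete := by
  intro n m r r' hr hr' hv
  have hmono : Literature.NumberTheory.Transcendental.KZ.relations ⊔ AddSubgroup.closure TorsionTied ≤
      Literature.NumberTheory.Transcendental.KZ.relations ⊔ AddSubgroup.closure (TorsionTied ∪ ComplexTied) :=
    sup_le_sup_left (AddSubgroup.closure_mono Set.subset_union_left) _
  exact hmono (torsionSectorComplete_iff.mp h r r' hr hr' hv)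

/-! ### Composition: the crux BY NAME from the three stubs -/

/-- **`TorsionSectorComplete` from the stubs** (closed term; `sorry` only through `stub_conjugateFold`,
`stub_realSideElimination`, `stub_complexPointsComplete`): the rung (stubs 1–2) folds the complex sector into the
moves (`closure T^{ℂ} ≤ relations`), so the residual's `relations ⊔ closure (T ∪ T^{ℂ})` is `≤ relations ⊔ closure T`.
[cite: KontsevichZagier2001, §1.2] -/
theorem TorsionSectorComplete_of :
    Summit.KontsevichZagierPeriods.KontsevichZagierPeriods.Theses.TorsionLogs.TorsionSectorComplete := by
  suffices key : ConjugateFold → RealSideElimination → ComplexPointsComplete →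
      Summit.KontsevichZagierPeriods.KontsevichZagierPeriods.Theses.TorsionLogs.TorsionSectorComplete from
    key stub_conjugateFold stub_realSideElimination stub_complexPointsComplete
  intro h₁ h₂ h₃
  rw [torsionSectorComplete_iff]
  intro n m r r' hr hr' hv
  have hR : NeronTorsionComplexPoints := neronTorsionComplexPoints_of h₁ h₂
  have hle : Literature.NumberTheory.Transcendental.KZ.relations ⊔ AddSubgroup.closure (TorsionTied ∪ ComplexTied) ≤
      Literature.NumberTheory.Transcendental.KZ.relations ⊔ AddSubgroup.closure TorsionTied := by
    refine sup_le le_sup_left ((AddSubgroup.closure_le _).mpr ?_)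
    rintro d (hd | hd)
    · exact AddSubgroup.mem_sup_right (AddSubgroup.subset_closure hd)
    · exact AddSubgroup.mem_sup_left (closure_complexTied_le_relations (hR true) (AddSubgroup.subset_closure hd))
  exact hle (h₃ r r' hr hr' hv)

end Summit.KontsevichZagierPeriods.KontsevichZagierPeriods.Cruxes.TorsionSectorComplete.NeronTorsionComplex

end
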